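import Summits.KontsevichZagierPeriods.KontsevichZagierPeriods.Theorems.RootDecompWalshStrataConicSection02
import Summits.KontsevichZagierPeriods.KontsevichZagierPeriods.Theorems.RootDecompWalshStrataSectorWalls01

/-!
# Root decomposition & Walsh strata — conic-wall SECTIONS on the stratum `k = 0` (gen 8, §38)

Route `RootDecompWalshStrata`, leaf `QuadricBakerDescent` (stmt-27597), residual R-E2 (NODE.md, decomp-kz-lens-4).
When `k = aκ₀ − l₁² = 0` the adapted conic wall `a(κ₀X² + κ₁Y²) + c = (l₀ + l₁X + l₂Y)²` is LINEAR in
`X`: `2l₁L(Y)·X = aκ₁Y² + c − L(Y)²`, so off the heights with `L(Y) = 0` the wall is the graph of the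
RATIONAL function `X = Xr(Y)` (`ConicWall.Xr`, ConicStrata) and a boundary section on it goes through the
height reparametrisation `InBaker.psection_height` to the terminal `InBaker.conic_height_k0` — whose only
non-degeneracy input `(L + l₁Xr)² − c ≠ 0` is AUTOMATIC: along the wall `(L + l₁Xr)² − c = a(κ₀Xr² + κ₁Y²)`.
At the heights with `L(Y) = 0` the wall forces `aκ₁Y² + c = 0`; with `l₂ ≠ 0` that height is the rational
`Y₀ = −l₀/l₂` and the section lies on the horizontal line `Y = Y₀` (`InBaker.psection_line`, or the null
wall `t = 0` when `l₀ = 0`).  No sign hypothesis on `c`.  [KontsevichZagier2001 §1.2 rule (2); BCR1998 §2.2; this node]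
-/

noncomputable section

open Set MeasureTheory Literature.NumberTheory.Transcendental
open Literature.ModelTheory.ExponentialFields (IsSemialgebraic isSemialgebraic_univ
  tarski_seidenberg_real_holds)

namespace Summit.KontsevichZagierPeriods.RootDecompWalshStrata.ConicDescent

/-! #### 38.1 Pointwise facts on the stratum `k = 0` -/

namespace ConicWall

variable (W : ConicWall)

/-- On `k = 0`, a wall point with `L(Y) ≠ 0` lies on the rational branch `X = Xr(Y)`. [this node] -/
theorem Xr_of_wall (hk : W.k = 0) (hl₁ : W.l₁ ≠ 0) (X Y : ℝ)
    (h : (W.a : ℝ) * (W.κ₀ * X ^ 2 + W.κ₁ * Y ^ 2) + W.c = (W.l₀ + W.l₁ * X + W.l₂ * Y) ^ 2)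
    (hL : W.L Y ≠ 0) : W.Xr Y = X := by
  have hl : (W.l₁ : ℝ) ≠ 0 := by exact_mod_cast hl₁
  have hk' : (W.a : ℝ) * W.κ₀ = W.l₁ ^ 2 := by
    have h0 : ((W.a * W.κ₀ - W.l₁ ^ 2 : ℚ) : ℝ) = 0 := by exact_mod_cast hk
    push_cast at h0
    linarith
  have hd : (2 : ℝ) * W.l₁ * W.L Y ≠ 0 := by positivity
  rw [Xr, div_eq_iff hd]
  simp only [L] at hL ⊢
  linear_combination h - X ^ 2 * hk'

/-- On `k = 0`, a wall point at a height with `L(Y) = 0` has `aκ₁Y² + c = 0`. [this node] -/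
theorem wall_L_zero (hk : W.k = 0) (X Y : ℝ)
    (h : (W.a : ℝ) * (W.κ₀ * X ^ 2 + W.κ₁ * Y ^ 2) + W.c = (W.l₀ + W.l₁ * X + W.l₂ * Y) ^ 2)
    (hL : W.L Y = 0) : (W.a : ℝ) * W.κ₁ * Y ^ 2 + W.c = 0 := by
  have hk' : (W.a : ℝ) * W.κ₀ = W.l₁ ^ 2 := by
    have h0 : ((W.a * W.κ₀ - W.l₁ ^ 2 : ℚ) : ℝ) = 0 := by exact_mod_cast hk
    push_cast at h0
    linarith
  simp only [L] at hL
  linear_combination h - X ^ 2 * hk' + (2 * W.l₁ * X + (W.l₀ + W.l₂ * Y)) * hL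

/-- `Xr` of a coordinate is semialgebraic where `L ≠ 0` (any ambient dimension). [this node] -/
theorem isSemialgebraicFunOn_Xr_coord (hl₁ : W.l₁ ≠ 0) {n : ℕ} {T : Set (Fin n → ℝ)}
    (hT : IsSemialgebraic ℚ T) (i : Fin n) (hL : ∀ v ∈ T, W.L (v i) ≠ 0) :
    IsSemialgebraicFunOn ℚ T fun v => W.Xr (v i) := by
  have hl : (W.l₁ : ℝ) ≠ 0 := by exact_mod_cast hl₁
  have h0 := isSemialgebraicFunOn_apply hT i
  have hLf : IsSemialgebraicFunOn ℚ T fun v => W.L (v i) :=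
    ((isSemialgebraicFunOn_ratCast hT W.l₀).add_holds
      ((isSemialgebraicFunOn_ratCast hT W.l₂).mul_holds h0)).congr fun v _ => by
      simp only [Pi.add_apply, Pi.mul_apply, L]
  exact (((((isSemialgebraicFunOn_ratCast hT (W.a * W.κ₁)).mul_holds (h0.mul_holds h0)).add_holds
    (isSemialgebraicFunOn_ratCast hT W.c)).sub_holds (hLf.mul_holds hLf)).div
    ((isSemialgebraicFunOn_ratCast hT (2 * W.l₁)).mul_holds hLf) fun v hv => by
      simp only [Pi.mul_apply]
      push_cast
      exact mul_ne_zero (mul_ne_zero two_ne_zero hl) (hL v hv)).congr fun v _ => by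
    simp only [Pi.add_apply, Pi.mul_apply, Pi.sub_apply, Xr]
    push_cast
    ring

/-! #### 38.2 The height set on the rational branch -/

/-- Auxiliary step `snoc2_zeroK`. [bookkeeping] -/
private theorem snoc2_zeroK (x : Fin 1 → ℝ) (t : ℝ) : (Fin.snoc x t : Fin 2 → ℝ) 0 = x 0 := rfl
/-- Auxiliary step `snoc2_oneK`. [bookkeeping] -/
private theorem snoc2_oneK (x : Fin 1 → ℝ) (t : ℝ) : (Fin.snoc x t : Fin 2 → ℝ) 1 = t := rfl
/-- Auxiliary step `snoc3_oneK`. [bookkeeping] -/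
private theorem snoc3_oneK (z : Fin 2 → ℝ) (t : ℝ) : (Fin.snoc z t : Fin 3 → ℝ) 1 = z 1 := rfl
/-- Auxiliary step `snoc3_twoK`. [bookkeeping] -/
private theorem snoc3_twoK (z : Fin 2 → ℝ) (t : ℝ) : (Fin.snoc z t : Fin 3 → ℝ) 2 = t := rfl

/-- **THE HEIGHT SET ON THE RATIONAL BRANCH IS SEMIALGEBRAIC** (two graph eliminations through the
graph of `ζ`, as in `isSemialgebraic_heightSet`). [BCR1998 Thm. 2.2.1; this node] -/
theorem isSemialgebraic_heightSetR (hi : ℚ) (hl₁ : W.l₁ ≠ 0) {A : Set (Fin 1 → ℝ)}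
    (ζ : (Fin 1 → ℝ) → ℝ) (hζ : IsSemialgebraicFunOn ℚ A ζ) :
    IsSemialgebraic ℚ {v : Fin 1 → ℝ |
      (W.L (v 0) ≠ 0 ∧ 0 < W.Xr (v 0) ∧ 0 ≤ v 0 ∧ v 0 ≤ (hi : ℝ)) ∧
      lift₁ (fun s => s / W.Xr s) v ∈ A ∧
      ζ (lift₁ (fun s => s / W.Xr s) v) = √(W.κ₀ * W.Xr (v 0) ^ 2 + W.κ₁ * v 0 ^ 2)} := by
  -- `L` and `L²` of a coordinate
  have hLf : ∀ {n : ℕ} {T : Set (Fin n → ℝ)} (_ : IsSemialgebraic ℚ T) (i : Fin n),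
      IsSemialgebraicFunOn ℚ T fun v => W.L (v i) := fun hT i =>
    ((isSemialgebraicFunOn_ratCast hT W.l₀).add_holds
      ((isSemialgebraicFunOn_ratCast hT W.l₂).mul_holds (isSemialgebraicFunOn_apply hT i))).congr
      fun v _ => by simp only [Pi.add_apply, Pi.mul_apply, L]
  have hL2 : ∀ {n : ℕ} {T : Set (Fin n → ℝ)} (_ : IsSemialgebraic ℚ T) (i : Fin n),
      IsSemialgebraicFunOn ℚ T fun v => W.L (v i) * W.L (v i) := fun hT i =>
    ((hLf hT i).mul_holds (hLf hT i)).congr fun v _ => by simp only [Pi.mul_apply]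
  -- the base set `U`
  have hU : IsSemialgebraic ℚ {v : Fin 1 → ℝ |
      W.L (v 0) ≠ 0 ∧ 0 < W.Xr (v 0) ∧ 0 ≤ v 0 ∧ v 0 ≤ (hi : ℝ)} := by
    have huniv : IsSemialgebraic ℚ (univ : Set (Fin 1 → ℝ)) := isSemialgebraic_univ
    have h1 : IsSemialgebraic ℚ {v : Fin 1 → ℝ | v ∈ univ ∧ 0 < W.L (v 0) * W.L (v 0)} :=
      IsSemialgebraicFunOn.isSemialgebraic_sep_pos (hL2 huniv 0)
    have h2 : IsSemialgebraic ℚ {v : Fin 1 → ℝ | v ∈ {v : Fin 1 → ℝ | v ∈ univ ∧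
        0 < W.L (v 0) * W.L (v 0)} ∧ 0 < W.Xr (v 0)} :=
      IsSemialgebraicFunOn.isSemialgebraic_sep_pos (W.isSemialgebraicFunOn_Xr_coord hl₁ h1 0
        fun v hv => mul_self_pos.1 hv.2)
    have h3 : IsSemialgebraic ℚ {v : Fin 1 → ℝ | v ∈ {v : Fin 1 → ℝ | v ∈ {v : Fin 1 → ℝ | v ∈ univ ∧
        0 < W.L (v 0) * W.L (v 0)} ∧ 0 < W.Xr (v 0)} ∧ 0 ≤ v 0 - ((0 : ℚ) : ℝ)} :=
      IsSemialgebraicFunOn.isSemialgebraic_sep_nonneg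
        ((isSemialgebraicFunOn_apply h2 0).sub_holds (isSemialgebraicFunOn_ratCast h2 0))
    have h4 : IsSemialgebraic ℚ {v : Fin 1 → ℝ | v ∈ {v : Fin 1 → ℝ | v ∈ {v : Fin 1 → ℝ |
        v ∈ {v : Fin 1 → ℝ | v ∈ univ ∧ 0 < W.L (v 0) * W.L (v 0)} ∧ 0 < W.Xr (v 0)} ∧
          0 ≤ v 0 - ((0 : ℚ) : ℝ)} ∧ 0 ≤ (hi : ℝ) - v 0} :=
      IsSemialgebraicFunOn.isSemialgebraic_sep_nonneg
        ((isSemialgebraicFunOn_ratCast h3 hi).sub_holds (isSemialgebraicFunOn_apply h3 0))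
    convert h4 using 1
    ext v
    simp only [mem_setOf_eq, mem_univ, true_and, Rat.cast_zero, sub_zero, sub_nonneg, mul_self_pos]
    tauto
  -- the graph of `ζ`, pulled back to `ℝ³` along `w ↦ (w 1, w 2)`
  have hG : IsSemialgebraic ℚ {z : Fin 2 → ℝ | ∃ x ∈ A, z = Fin.snoc x (ζ x)} := hζ
  have hT2 := hG.preimage_comp (![1, 2] : Fin 2 → Fin 3)
  -- the norm `√(κ₀Xr(Y)² + κ₁Y²)` as a function on `{L(Y) ≠ 0} ⊆ ℝ²` (of the first coordinate)
  have huniv2 : IsSemialgebraic ℚ (univ : Set (Fin 2 → ℝ)) := isSemialgebraic_univ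
  have hD2 : IsSemialgebraic ℚ {z : Fin 2 → ℝ | z ∈ univ ∧ 0 < W.L (z 0) * W.L (z 0)} :=
    IsSemialgebraicFunOn.isSemialgebraic_sep_pos (hL2 huniv2 0)
  have hX2 := W.isSemialgebraicFunOn_Xr_coord hl₁ hD2 0 fun z hz => mul_self_pos.1 hz.2
  have h02 := isSemialgebraicFunOn_apply hD2 (0 : Fin 2)
  have hNm : IsSemialgebraicFunOn ℚ {z : Fin 2 → ℝ | z ∈ univ ∧ 0 < W.L (z 0) * W.L (z 0)}
      fun z => √(W.κ₀ * W.Xr (z 0) ^ 2 + W.κ₁ * z 0 ^ 2) :=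
    (IsSemialgebraicFunOn.sqrt_holds ((((isSemialgebraicFunOn_ratCast hD2 W.κ₀).mul_holds
      (hX2.mul_holds hX2)).add_holds ((isSemialgebraicFunOn_ratCast hD2 W.κ₁).mul_holds
      (h02.mul_holds h02))))).congr fun z _ => by
      simp only [Pi.add_apply, Pi.mul_apply]
      ring_nf
  have hT1 := IsSemialgebraicFunOn.isSemialgebraic_sep_snoc_mem tarski_seidenberg_real_holds hNm hT2
  -- the slope as a function on `U`
  have hφ : IsSemialgebraicFunOn ℚ {v : Fin 1 → ℝ |
      W.L (v 0) ≠ 0 ∧ 0 < W.Xr (v 0) ∧ 0 ≤ v 0 ∧ v 0 ≤ (hi : ℝ)} fun v => v 0 / W.Xr (v 0) :=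
    (isSemialgebraicFunOn_apply hU 0).div (W.isSemialgebraicFunOn_Xr_coord hl₁ hU 0
      fun v hv => hv.1) fun v hv => hv.2.1.ne'
  have hT0 := IsSemialgebraicFunOn.isSemialgebraic_sep_snoc_mem tarski_seidenberg_real_holds hφ hT1
  convert hT0 using 1
  ext v
  simp only [mem_setOf_eq, mem_univ, true_and, mem_preimage, snoc2_zeroK]
  constructor
  · rintro ⟨hU', hA', hζ'⟩
    refine ⟨hU', mul_self_pos.2 hU'.1, lift₁ (fun s => s / W.Xr s) v, hA', ?_⟩
    funext j
    fin_cases j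
    · simp [snoc3_oneK]
    · simp [snoc3_twoK, hζ']
  · rintro ⟨hU', -, x, hxA, hx⟩
    have h0 := congrFun hx 0
    have h1 := congrFun hx 1
    simp only [Function.comp_apply, Matrix.cons_val_zero, Matrix.cons_val_one, snoc3_oneK, snoc3_twoK,
      snoc2_zeroK, snoc2_oneK] at h0 h1
    have hx' : lift₁ (fun s => s / W.Xr s) v = x := by
      funext j
      have hj := Fin.eq_zero j
      subst hj
      rw [lift₁_apply, h0]
    rw [hx']
    exact ⟨hU', hxA, h1.symm⟩

end ConicWall

namespace BallCube

/-! #### 38.3 A section on the rational branch -/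

/-- **CONIC-WALL SECTION ON THE RATIONAL BRANCH** (`k = 0`, heights with `L(Y) ≠ 0`): height
reparametrisation over `isSemialgebraic_heightSetR` + the terminal `InBaker.conic_height_k0`; no sign
hypothesis on `c`. [this node] -/
theorem InBaker.psection_conic_k0L (W : ConicWall) (hκ : 0 < W.κ₀ ∧ 0 ≤ W.κ₁) (γ : ℚ)
    (ha : W.a ≠ 0) (hk : W.k = 0) (hl₁ : W.l₁ ≠ 0)
    {A : Set (Fin 1 → ℝ)} (ζ : (Fin 1 → ℝ) → ℝ)
    (hζsa : IsSemialgebraicFunOn ℚ A ζ) (hA01 : ∀ x ∈ A, 0 ≤ x 0 ∧ x 0 ≤ 1)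
    (hζ : ∀ x ∈ A, 0 < ζ x ∧ ζ x ^ 2 ≤ 1)
    (hLA : ∀ x ∈ A, W.L (secX W.κ₀ W.κ₁ ζ x * x 0) ≠ 0)
    (hwall : ∀ x ∈ A, (W.a : ℝ) * (W.κ₀ * secX W.κ₀ W.κ₁ ζ x ^ 2 +
      W.κ₁ * (secX W.κ₀ W.κ₁ ζ x * x 0) ^ 2) + W.c =
      (W.l₀ + W.l₁ * secX W.κ₀ W.κ₁ ζ x + W.l₂ * (secX W.κ₀ W.κ₁ ζ x * x 0)) ^ 2)
    (r₁ : KZ.IntegralRep 1) (hr₁ : r₁.domain = A)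
    (hint : EqOn r₁.integrand (fun x => ppot W.κ₀ W.κ₁ γ W.a W.c (Fin.snoc x (ζ x))) A) :
    InBaker (KZ.of r₁) := by
  have hκ0 : (0 : ℝ) < W.κ₀ := by exact_mod_cast hκ.1
  have hκ1 : (0 : ℝ) ≤ W.κ₁ := by exact_mod_cast hκ.2
  have ha' : (W.a : ℝ) ≠ 0 := by exact_mod_cast ha
  -- a rational bound for the heights
  set hi : ℚ := 1 + 1 / W.κ₀ with hhi
  have hhi1 : (1 : ℝ) ≤ hi := by
    have h' : (0 : ℚ) ≤ 1 / W.κ₀ := one_div_nonneg.mpr hκ.1.le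
    have h'' : (1 : ℚ) ≤ hi := by rw [hhi]; linarith
    exact_mod_cast h''
  have hhi2 : (1 : ℝ) ≤ hi * W.κ₀ := by
    have h' : hi * W.κ₀ = W.κ₀ + 1 := by
      rw [hhi, add_mul, one_mul, one_div_mul_cancel hκ.1.ne']
    have h'' : (1 : ℚ) ≤ hi * W.κ₀ := by rw [h']; linarith [hκ.1]
    exact_mod_cast h''
  have hT₀ := W.isSemialgebraic_heightSetR hi hl₁ ζ hζsa
  have hLT : ∀ v ∈ {v : Fin 1 → ℝ |
      (W.L (v 0) ≠ 0 ∧ 0 < W.Xr (v 0) ∧ 0 ≤ v 0 ∧ v 0 ≤ (hi : ℝ)) ∧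
      lift₁ (fun s => s / W.Xr s) v ∈ A ∧
      ζ (lift₁ (fun s => s / W.Xr s) v) = √(W.κ₀ * W.Xr (v 0) ^ 2 + W.κ₁ * v 0 ^ 2)},
      W.L (v 0) ≠ 0 := fun v hv => hv.1.1
  refine InBaker.psection_height hκ γ W.a W.c hT₀ W.Xr W.Xr'
    ((W.isRatOn_Xr hLT hl₁).isSemialgebraicFunOn hT₀)
    ((W.isRatOn_Xr' hLT hl₁).isSemialgebraicFunOn hT₀)
    (fun v hv => hv.1.2.1) (fun v hv => W.hasDerivAt_Xr (v 0) hv.1.1 hl₁)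
    (fun u hu v hv huv => ?_) (fun x hx => ?_) ζ (fun v hv _ => hv.2.2) r₁ hr₁ hint
    fun r hrd hri => ?_
  · -- the slope is injective on the height set
    exact height_inj_of_norm hκ (X := W.Xr) (ζ := fun s => ζ fun _ => s) hu.1.2.1 hv.1.2.1
      hu.2.2 hv.2.2 huv
  · -- every section point is reached
    obtain ⟨hz, hz1⟩ := hζ x hx
    obtain ⟨hx0, hx1⟩ := hA01 x hx
    have hN := pN_pos hκ (x 0)
    set Xs := secX W.κ₀ W.κ₁ ζ x with hXs
    set Ys := Xs * x 0 with hYs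
    have hXpos : 0 < Xs := div_pos hz hN
    have hXr : W.Xr Ys = Xs := W.Xr_of_wall hk hl₁ Xs Ys (hwall x hx) (hLA x hx)
    have hnorm : (W.κ₀ : ℝ) * Xs ^ 2 + W.κ₁ * Ys ^ 2 = ζ x ^ 2 := norm_secX hκ ζ x
    have hXhi : Xs ≤ hi := by
      have h1 : Xs ^ 2 * W.κ₀ ≤ 1 := by nlinarith [mul_nonneg hκ1 (sq_nonneg Ys)]
      by_contra hcon
      rw [not_le] at hcon
      have h2 : (hi : ℝ) * (hi * W.κ₀) ≤ Xs * (hi * W.κ₀) :=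
        mul_le_mul_of_nonneg_right hcon.le (by positivity)
      have h3 : (hi : ℝ) * (Xs * W.κ₀) < Xs * (Xs * W.κ₀) :=
        mul_lt_mul_of_pos_right hcon (mul_pos hXpos hκ0)
      nlinarith
    have hx' : lift₁ (fun s => s / W.Xr s) (fun _ => Ys) = x := by
      funext j
      have hj := Fin.eq_zero j
      subst hj
      rw [lift₁_apply, hXr, hYs]
      field_simp
    refine ⟨fun _ => Ys, ⟨⟨hLA x hx, by rw [hXr]; exact hXpos, mul_nonneg hXpos.le hx0, ?_⟩,
      by rw [hx']; exact hx, ?_⟩, ?_⟩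
    · calc Ys = Xs * x 0 := rfl
        _ ≤ Xs * 1 := by gcongr
        _ ≤ hi := by rw [mul_one]; exact hXhi
    · rw [hx', hXr, hnorm, Real.sqrt_sq hz.le]
    · show Ys / W.Xr Ys = x 0
      rw [hXr, hYs]
      field_simp
  · -- the height integral: the rational-branch terminal
    refine InBaker.conic_height_k0 W γ hk hl₁ ha ⟨hκ.1.le, hκ.2⟩ r (fun v hv => ?_)
      (fun v hv => ?_) (fun v hv => ?_) fun v _ => by rw [hri]
    · rw [hrd] at hv
      exact hv.1.1.1
    · rw [hrd] at hv
      exact hv.1.1.2.1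
    · rw [hrd] at hv
      have hL := hv.1.1.1
      have hX := hv.1.1.2.1
      rw [← W.Xr_wall hk hl₁ (v 0) hL, add_sub_cancel_right]
      refine mul_ne_zero ha' (ne_of_gt ?_)
      nlinarith [mul_nonneg hκ1 (sq_nonneg (v 0)), mul_pos hκ0 (pow_pos hX 2)]

/-! #### 38.4 The section theorem on the stratum `k = 0` -/

/-- **CONIC-WALL SECTION, `k = 0`.**  A boundary section `(S, ζ)` whose wall points lie on the adapted conic
wall with `k = aκ₀ − l₁² = 0` and `L ≢ 0` is in the Baker class (any sign of `c`): the heights with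
`L(Y) ≠ 0` go to `InBaker.psection_conic_k0L`; at the heights with `L(Y) = 0` the wall forces
`aκ₁Y² + c = 0`, and with `l₂ ≠ 0` the piece lies on the rational horizontal line `Y = −l₀/l₂`
(`InBaker.psection_line`, or the null wall `t = 0` when `l₀ = 0`); with `l₂ = 0` that piece is empty.
[KontsevichZagier2001 §1.2; this node] -/
theorem InBaker.psection_conic_k0 (W : ConicWall) (hκ : 0 < W.κ₀ ∧ 0 ≤ W.κ₁) (γ : ℚ) (ha : W.a ≠ 0)
    (hk : W.k = 0) (hL0 : W.l₀ ≠ 0 ∨ W.l₂ ≠ 0)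
    {S : Set (Fin 1 → ℝ)} (ζ : (Fin 1 → ℝ) → ℝ)
    (hζsa : IsSemialgebraicFunOn ℚ S ζ) (hS01 : ∀ x ∈ S, 0 ≤ x 0 ∧ x 0 ≤ 1)
    (hζ : ∀ x ∈ S, 0 < ζ x ∧ ζ x ^ 2 ≤ 1)
    (hwall : ∀ x ∈ S, (W.a : ℝ) * ζ x ^ 2 + W.c =
      (W.l₀ + (W.l₁ + W.l₂ * x 0) * (ζ x / pN W.κ₀ W.κ₁ (x 0))) ^ 2)
    (r₁ : KZ.IntegralRep 1) (hr₁ : r₁.domain ⊆ S)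
    (hint : EqOn r₁.integrand (fun x => ppot W.κ₀ W.κ₁ γ W.a W.c (Fin.snoc x (ζ x))) r₁.domain) :
    InBaker (KZ.of r₁) := by
  have hκ0 : (0 : ℝ) < W.κ₀ := by exact_mod_cast hκ.1
  have ha' : (W.a : ℝ) ≠ 0 := by exact_mod_cast ha
  -- `l₁ ≠ 0` since `l₁² = aκ₀ ≠ 0`
  have hl₁ : W.l₁ ≠ 0 := by
    intro h
    have h1 : W.a * W.κ₀ = 0 := by
      have h2 : W.a * W.κ₀ - W.l₁ ^ 2 = 0 := hk
      rw [h] at h2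
      linarith
    rcases mul_eq_zero.1 h1 with h3 | h3
    · exact ha h3
    · exact hκ.1.ne' h3
  have hD := r₁.isSemialgebraic_domain
  have hζD : IsSemialgebraicFunOn ℚ r₁.domain ζ := hζsa.mono hr₁ hD
  have hX := isSemialgebraicFunOn_secX hκ hD hζD
  have h0 := isSemialgebraicFunOn_apply hD (0 : Fin 1)
  -- `L` at the wall point, as a function of the slope
  have hLf : IsSemialgebraicFunOn ℚ r₁.domain fun x => W.L (secX W.κ₀ W.κ₁ ζ x * x 0) :=
    ((isSemialgebraicFunOn_ratCast hD W.l₀).add_holds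
      ((isSemialgebraicFunOn_ratCast hD W.l₂).mul_holds (hX.mul_holds h0))).congr fun x _ => by
      simp only [Pi.add_apply, Pi.mul_apply, ConicWall.L]
  -- the wall relation at the wall point
  have hwall' : ∀ x ∈ r₁.domain, (W.a : ℝ) * (W.κ₀ * secX W.κ₀ W.κ₁ ζ x ^ 2 +
      W.κ₁ * (secX W.κ₀ W.κ₁ ζ x * x 0) ^ 2) + W.c =
      (W.l₀ + W.l₁ * secX W.κ₀ W.κ₁ ζ x + W.l₂ * (secX W.κ₀ W.κ₁ ζ x * x 0)) ^ 2 := fun x hx => by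
    rw [norm_secX hκ ζ x, hwall x (hr₁ hx), secX]
    ring
  -- the pieces
  have hz0 : IsSemialgebraicFunOn ℚ r₁.domain fun _ => (0 : ℝ) :=
    (isSemialgebraicFunOn_ratCast hD 0).congr fun _ _ => by simp
  have hLf2 : IsSemialgebraicFunOn ℚ r₁.domain fun x =>
      W.L (secX W.κ₀ W.κ₁ ζ x * x 0) * W.L (secX W.κ₀ W.κ₁ ζ x * x 0) :=
    (hLf.mul_holds hLf).congr fun x _ => by simp only [Pi.mul_apply]
  set A : Set (Fin 1 → ℝ) := {x | x ∈ r₁.domain ∧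
    0 < W.L (secX W.κ₀ W.κ₁ ζ x * x 0) * W.L (secX W.κ₀ W.κ₁ ζ x * x 0)} with hA_def
  set Z : Set (Fin 1 → ℝ) := {x | x ∈ r₁.domain ∧
    W.L (secX W.κ₀ W.κ₁ ζ x * x 0) = (fun _ => (0 : ℝ)) x} with hZ_def
  have hA : IsSemialgebraic ℚ A := IsSemialgebraicFunOn.isSemialgebraic_sep_pos hLf2
  have hZ : IsSemialgebraic ℚ Z := isSemialgebraic_sep_eq hLf hz0
  have hAr : A ⊆ r₁.domain := fun x hx => hx.1
  have hZr : Z ⊆ r₁.domain := fun x hx => hx.1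
  have hAL : ∀ x ∈ A, W.L (secX W.κ₀ W.κ₁ ζ x * x 0) ≠ 0 := fun x hx => mul_self_pos.1 hx.2
  have hZL : ∀ x ∈ Z, W.L (secX W.κ₀ W.κ₁ ζ x * x 0) = 0 := fun x hx => hx.2
  refine InBaker.of_split r₁ hA hZ hAr hZr ?_ ?_ ?_ ?_
  · ext x
    simp only [hA_def, hZ_def, mem_union, mem_setOf_eq, mul_self_pos]
    constructor
    · intro hx
      by_cases h : W.L (secX W.κ₀ W.κ₁ ζ x * x 0) = 0
      · exact Or.inr ⟨hx, h⟩
      · exact Or.inl ⟨hx, h⟩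
    · rintro (⟨hx, _⟩ | ⟨hx, _⟩) <;> exact hx
  · have : A ∩ Z = ∅ := by
      ext x
      simp only [mem_inter_iff, mem_empty_iff_false, iff_false]
      rintro ⟨hxA, hxZ⟩
      exact hAL x hxA (hZL x hxZ)
    rw [this, measure_empty]
  · -- heights with `L ≠ 0`: the rational branch
    exact InBaker.psection_conic_k0L W hκ γ ha hk hl₁ ζ (hζD.mono hAr hA)
      (fun x hx => hS01 x (hr₁ (hAr hx))) (fun x hx => hζ x (hr₁ (hAr hx))) hAL
      (fun x hx => hwall' x (hAr hx)) _ rfl fun x hx => hint (hAr hx)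
  · -- heights with `L = 0`
    by_cases hl₂ : W.l₂ = 0
    · -- `L ≡ l₀ ≠ 0`: the piece is empty
      have hl₀ : W.l₀ ≠ 0 := hL0.resolve_right (fun h => h hl₂)
      refine InBaker.of_domain_eq_empty _ (eq_empty_of_forall_notMem fun x hx => ?_)
      have h := hZL x hx
      simp only [ConicWall.L, hl₂, Rat.cast_zero, zero_mul, add_zero] at h
      exact hl₀ (by exact_mod_cast h)
    -- `l₂ ≠ 0`: the piece lies on the horizontal line `Y = −l₀/l₂`
    have hline : ∀ x ∈ Z, ζ x * (((0 : ℚ) : ℝ) + W.l₂ * x 0) = -W.l₀ * pN W.κ₀ W.κ₁ (x 0) := by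
      intro x hx
      have hN := pN_pos hκ (x 0)
      have h := hZL x hx
      simp only [ConicWall.L, secX] at h
      have key := congrArg (· * pN W.κ₀ W.κ₁ (x 0)) h
      simp only [zero_mul] at key
      have e1 : (W.l₂ : ℝ) * (ζ x / pN W.κ₀ W.κ₁ (x 0) * x 0) * pN W.κ₀ W.κ₁ (x 0) =
          W.l₂ * (ζ x * x 0) := by
        field_simp
      push_cast
      linear_combination key - e1
    by_cases hl₀ : W.l₀ = 0
    · -- through the centre: the null wall `t = 0`
      refine InBaker.of_subset_zeroSet _ (MvPolynomial.X 0 : MvPolynomial (Fin 1) ℚ)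
        ⟨fun _ => 1, by simp⟩ fun x hx => ?_
      have h := hline x hx
      rw [hl₀, Rat.cast_zero, neg_zero, zero_mul, zero_add, mul_eq_zero] at h
      rcases h with h | h
      · exact absurd h (hζ x (hr₁ (hZr hx))).1.ne'
      · rcases mul_eq_zero.1 h with h | h
        · exact absurd h (by exact_mod_cast hl₂)
        · simpa using h
    · exact InBaker.psection_line hκ γ W.a W.c ha W.l₀ 0 W.l₂ hl₀ (S := Z) ζ
        (fun x hx => hS01 x (hr₁ (hZr hx))) (fun x hx => hζ x (hr₁ (hZr hx))) hline _
        (fun x hx => hx) fun x hx => hint (hZr hx)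

end BallCube

end Summit.KontsevichZagierPeriods.RootDecompWalshStrata.ConicDescent

end
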